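import Summits.ValiantsHypothesis.ValiantsHypothesis.Theorems.DepthWindowRiffleBridge
import Literature.Computability.AlgebraicComplexity.GenWordDefs
import Mathlib.Data.Complex.Basic
import HarnessLib.Audit.Tags

/-!
# Route `DepthWindow` — the TREE-BIAS BRIDGE to the A-cell `Hard(2)` (crux `HomImmHardTwoOne`)

Cone-free helper of the decomp-valiant workshop (lens 4, generation 12), supporting the crux item
`HomImmHardTwoOne` (stmt-ValiantsHypothesis-30635) of `Theses/DepthWindow.lean`.

**What it records.**  Inside the lopsided relative-rank method (`relrk_w`, LST 2021/2025) the threshold-LAW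
template is capped at slope `1/log₂ φ` uniformly in the word (`DepthWindowLawCap*.lean`, g12: every
law-engine instance has `ε ≥ 2^{-2(⌊log₂ n⌋+1)}` at the cell), because the law engine charges the MAXIMUM
over levels.  Limaye–Srinivasan–Tavenas (CCC 2022) show that for set-multilinear FORMULAS the method is
EXACTLY as strong as a purely additive-combinatorial quantity of the weight multiset `W`, the *depth-`Δ` tree
bias* `Treebias_Δ(W)` (Def. 2, Thm. 3: formulas of product-depth `Δ` and size `s` have
`relrk_W ≤ d^{3d}·s·n^{-Treebias/2}·(max relrk)`, and conversely `3d·n^{Treebias/2}` leaves suffice), which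
ACCUMULATES along root-to-node paths.  This file types that quantity for the tree's integer words
(`GenWord.wt sz pos : Fin d → ℤ`, weights in bits) as the predicate `TreeBiasGe w Δ τ`
("every levelled `W`-tree of depth `Δ` has an internal path of bias `≥ τ`"), and proves (0 sorry) the
composition

  `treeBiasBridge : HomUnroll → SmlizeFormulaDepth → TreeBiasImmFormula → TreeBiasGrowth → HomImmHardAll`

— two print theorems stated as `Prop`s (unrolling, g11; LST 2025 Lemma 12 with its depth clause; LST 2022
Thm. 3(1) combined with the `IMM → P_w` restriction of LST 2025 Lemma 8 and `relrk_w(P_w) = max`), ONE open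
combinatorial statement `TreeBiasGrowth` (words fitting `IMM_{m,⌊√log₂ m⌋}` whose depth-`Δ` tree bias exceeds
`C·(Δ_max+1)·log₂ m` bits for every `C`, at every depth slope), and the conclusion `∀ p q, HomImmHardAt p q`
spelled verbatim (`p = 2, q = 1` is the crux).  By LST 2022 Thm. 3 (both directions) `TreeBiasGrowth` is, up to
the `d^{3d}`/`2^{-d}` slack, EQUIVALENT to "the lopsided relative-rank method proves the A-cell for
set-multilinear formulas"; so this is the last door of that method family at the cell, typed.  Known:
`max_W Treebias_Δ(W) ≤ d^{1/Δ^{Ω(log Δ)}}` for `Δ = 2^{o(√log log d)}` (LST 2022 Thm. 5 — superconstant at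
`Δ = Θ(log log d)`, so no obstruction), `= Θ(d^{1/4})` at `Δ = 3` (Thm. 4); the two-letter continued-fraction
words of Bhargav–Dutta–Saxena give tree bias `O(Δ + γ)` (ToCT 2024, Thm. 1.7), i.e. only `Θ(Δ)` at the cell.
HONEST FRAMING: a CONDITIONAL bridge; `TreeBiasGrowth` is OPEN (LST 2022 Question 1 expects the method to
fail at depth `(log d)^{Ω(1)}`, which does not decide `Θ(log log d)`); nothing here bears on `VP ≠ VNP` itself.

References: [LimayeSrinivasanTavenas2022] N. Limaye, S. Srinivasan, S. Tavenas, On the partial derivative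
method applied to lopsided set-multilinear polynomials, CCC 2022, LIPIcs 234, Art. 32, Def. 2, Thm. 3–5,
Question 1; [LimayeSrinivasanTavenas2025] J. ACM 72 (2025) Art. 26, Lemma 8, Lemma 12;
[BhargavDuttaSaxena2024] ACM ToCT 16 (2024), Thm. 1.7, §5.3; [Burgisser2000] §2.1.
-/

-- layout Summits/ValiantsHypothesis/ValiantsHypothesis forces the duplicated namespace component
set_option linter.dupNamespace false

namespace Summit.ValiantsHypothesis.ValiantsHypothesis.Theorems.DepthWindow.TreeBias

open MvPolynomial Literature.Computability.AlgebraicComplexity ArithCircuit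
open Summit.ValiantsHypothesis.ValiantsHypothesis.Theorems.DepthWindow.Riffle

/-! ### Levelled `W`-trees and tree bias (LST 2022, Definition 2) -/

/-- A *levelled `W`-tree* on `d` leaves: level `0` consists of the singletons, and the block of leaf `i` at
level `t` is the class `{j | lab t j = lab t i}`; classes can only merge going up (`refine`).  A depth-`Δ`
`W`-tree of LST 2022 (Def. 2) is such a labelling whose level `Δ` is a single block; unary nodes are
allowed, so trees with leaves at smaller depth are represented by padding, which does not increase any path
bias. [cite: LimayeSrinivasanTavenas2022, Def. 2] -/
structure LTree (d : ℕ) where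
  /-- the block label of leaf `i` at level `t` -/
  lab : ℕ → Fin d → Fin d
  /-- level `0` = the leaves -/
  leaf : ∀ i, lab 0 i = i
  /-- blocks at level `t + 1` are unions of blocks at level `t` -/
  refine : ∀ t i j, lab t i = lab t j → lab (t + 1) i = lab (t + 1) j

variable {d : ℕ}

/-- `Sum(v)` for the node `v` = the block with label `l` at level `t`: the sum of the weights of its leaves.
[cite: LimayeSrinivasanTavenas2022, Def. 2] -/
def blockSum (w : Fin d → ℤ) (T : LTree d) (t : ℕ) (l : Fin d) : ℤ :=
  ∑ j ∈ Finset.univ.filter (fun j => T.lab t j = l), w j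

/-- The off-path cost of the internal path from the root (level `Δ`) down to the node of leaf `i` at level
`t ≥ 1`: `∑_{v ∈ Offpath(π)} |Sum(v)|`, where `Offpath(π)` consists of the children of path nodes that are
not on the path — at the end node (level `t`) ALL children count. [cite: LimayeSrinivasanTavenas2022, Def. 2] -/
def offCost (w : Fin d → ℤ) (T : LTree d) (Δ t : ℕ) (i : Fin d) : ℤ :=
  ∑ u ∈ Finset.Icc t Δ,
    ∑ l ∈ ((Finset.univ.filter (fun j => T.lab u j = T.lab u i)).image (T.lab (u - 1))).filter
        (fun l => u = t ∨ l ≠ T.lab (u - 1) i),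
      |blockSum w T (u - 1) l|

/-- `T` (read as a depth-`Δ` tree) has an internal path of bias `≥ τ`:
`bias(π) = ∑_{v ∈ Offpath(π)} |Sum(v)| - |Sum(root)|`. [cite: LimayeSrinivasanTavenas2022, Def. 2] -/
def HasBias (w : Fin d → ℤ) (T : LTree d) (Δ : ℕ) (τ : ℕ) : Prop :=
  ∃ t : ℕ, ∃ i : Fin d, 1 ≤ t ∧ t ≤ Δ ∧ (τ : ℤ) ≤ offCost w T Δ t i - |∑ j, w j|

/-- **`Treebias_Δ(W) ≥ τ`** (in bits, for an integer word `w`): every levelled `W`-tree whose level `Δ` is a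
single block has an internal path of bias at least `τ`.  (LST 2022: `Treebias_Δ(W)` = the minimum over
depth-`Δ` `W`-trees of the maximum path bias.) [cite: LimayeSrinivasanTavenas2022, Def. 2] -/
def TreeBiasGe (w : Fin d → ℤ) (Δ τ : ℕ) : Prop :=
  ∀ T : LTree d, (∀ i j, T.lab Δ i = T.lab Δ j) → HasBias w T Δ τ

/-- Sanity check of the bookkeeping at depth `1` (the star): the only internal path is the root itself and its
bias is `‖W‖₁ - |Sum W|`; here for the word `(+1,-1)`: tree bias `≥ 2`. [folklore] -/
example : HasBias (d := 2) ![1, -1] ⟨fun t i => if t = 0 then i else 0, fun i => by simp,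
    fun t i j _ => by simp⟩ 1 2 := by
  refine ⟨1, 0, le_rfl, le_rfl, ?_⟩
  decide

/-! ### The inputs and the conclusion -/

/-- **Set-multilinearisation of homogeneous formulas, with the depth clause** (LST 2025 Lemma 12, formula
version, as `Riffle.SmlizeFormula` plus `productDepth P' ≤ productDepth P`, which the proof in print gives:
the gates `α_S` are arranged along the original formula).  Print; unported.
[cite: LimayeSrinivasanTavenas2025, Lemma 12] -/
@[conjecture] def SmlizeFormulaDepth : Prop :=
  ∃ a : ℕ, ∀ (σ ι : Type) [Fintype σ] [DecidableEq σ] [Fintype ι] [DecidableEq ι] (blk : σ → ι)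
    (f : MvPolynomial σ ℂ), IsSetMultilinear blk Finset.univ f → ∀ P : ArithCircuit ℂ σ,
      P.IsFormula → (∀ g ∈ gateValues P.gates, ∃ e : ℕ, g.IsHomogeneous e) → P.Computes f →
      ∃ P' : ArithCircuit ℂ σ, IsSmlFormula ℂ blk P' ∧ P'.Computes f ∧
        P'.productDepth ≤ P.productDepth ∧
        P'.edgeSize ≤ (P.edgeSize + Fintype.card σ + 2) ^ a *
          2 ^ (a * Fintype.card ι * Fintype.card ι * (P.productDepth + 1))

/-- **Tree bias bounds set-multilinear `IMM` formulas** (LST 2022 Thm. 3(1) — `relrk_W(F) ≤ d^{3d}·s·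
n^{-Treebias_Δ(W)/2}·n^{-|Sum W|/2}` for set-multilinear formulas of product-depth `≤ Δ` and size `≤ s` —
applied to the restriction `IMM_{n,d} ↦ P_w` along `GenWord.wordSubst` (block-preserving linear, LST 2025
Lemma 8: size and product-depth do not grow, set-multilinearity is kept) and `relrk_w(P_w) = 2^{-|w_{[d]}|/2}`
(the maximum; `GenWord.relRank_wordPoly_eq`), in bits: a set-multilinear formula of product-depth `≤ Δ` and
edge size `E` for `IMM_{n,d}`, and a word `w` fitting in `n` with `Treebias_Δ(w) ≥ τ` bits, force
`2^{τ/2} ≤ d^{3d}·(E+1)`.  Print; unported. [cite: LimayeSrinivasanTavenas2022, Thm. 3]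
[cite: LimayeSrinivasanTavenas2025, Lemma 8] -/
@[conjecture] def TreeBiasImmFormula : Prop :=
  ∀ (n d Δ τ : ℕ) (sz : Fin d → ℕ) (pos : Fin d → Bool), 1 ≤ Δ → (∀ i, 1 ≤ sz i) →
    (∀ t ≤ d, 2 ^ GenWord.overLen sz pos t ≤ n) → TreeBiasGe (GenWord.wt sz pos) Δ τ →
    ∀ F : ArithCircuit ℂ (Fin d × Fin n × Fin n),
      IsSmlFormula ℂ (Prod.fst : Fin d × Fin n × Fin n → Fin d) F → F.Computes (immPoly n d ℂ) →
      F.productDepth ≤ Δ → 2 ^ (τ / 2) ≤ d ^ (3 * d) * (F.edgeSize + 1)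

/-- **The open combinatorial statement: tree bias outgrows the depth at every slope.**  For all `a c C`,
from some `m₀` on, at every depth `Δ ≤ a·L₃(m) + c + 1` (`L₃ = ⌊log₂⌊log₂⌊log₂ m⌋⌋⌋`) there is an integer
word on `d = ⌊√⌊log₂ m⌋⌋` letters fitting `IMM_{m,d}` (all prefix overhangs `≤ log₂ m` bits) whose depth-`Δ`
tree bias is at least `2·C·(a·L₃(m)+c+2)·⌊log₂ m⌋` bits — i.e. `Treebias/((Δ+1)·letter scale) → ∞`.  By LST
2022 Thm. 3 this is what the lopsided relative-rank method needs (and, for formulas, all it can use) at the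
A-cell; two-letter continued-fraction words reach only `Θ(Δ)` (BDS 2024 Thm. 1.7) and threshold-law
instances are capped (`DepthWindowLawCapCell`).  OPEN. [cite: LimayeSrinivasanTavenas2022, Thm. 3, Thm. 5,
Question 1] [cite: BhargavDuttaSaxena2024, Thm. 1.7] -/
@[conjecture] def TreeBiasGrowth : Prop :=
  ∀ a c C : ℕ, ∃ m₀ : ℕ, ∀ m : ℕ, m₀ ≤ m →
    ∀ Δ : ℕ, Δ ≤ a * Nat.log 2 (Nat.log 2 (Nat.log 2 m)) + c + 1 →
      ∃ (sz : Fin (Nat.sqrt (Nat.log 2 m)) → ℕ) (pos : Fin (Nat.sqrt (Nat.log 2 m)) → Bool),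
        (∀ i, 1 ≤ sz i) ∧ (∀ t ≤ Nat.sqrt (Nat.log 2 m), 2 ^ GenWord.overLen sz pos t ≤ m) ∧
        TreeBiasGe (GenWord.wt sz pos) Δ
          (2 * (C * (a * Nat.log 2 (Nat.log 2 (Nat.log 2 m)) + c + 2) * Nat.log 2 m))

/-- **The tree-bias bridge** (the implication proved below as `treeBiasBridge`; a composition, not a fact):
`HomUnroll → SmlizeFormulaDepth → TreeBiasImmFormula → TreeBiasGrowth → HomImmHardAll`. -/
def TreeBiasBridge : Prop :=
  HomUnroll → SmlizeFormulaDepth → TreeBiasImmFormula → TreeBiasGrowth → HomImmHardAll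

/-! ### Arithmetic helpers -/

/-- A sum of at most `5` terms each `≤ m^e` is `≤ m^(e+1)` once `m ≥ 5`. [folklore] -/
private theorem sum5_le_pow_succ {m e x₁ x₂ x₃ x₄ x₅ : ℕ} (hm : 5 ≤ m) (h₁ : x₁ ≤ m ^ e) (h₂ : x₂ ≤ m ^ e)
    (h₃ : x₃ ≤ m ^ e) (h₄ : x₄ ≤ m ^ e) (h₅ : x₅ ≤ m ^ e) : x₁ + x₂ + x₃ + x₄ + x₅ ≤ m ^ (e + 1) := by
  calc x₁ + x₂ + x₃ + x₄ + x₅ ≤ 5 * m ^ e := by omega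
    _ ≤ m * m ^ e := Nat.mul_le_mul_right _ hm
    _ = m ^ (e + 1) := by ring

/-- `2^(x·e) ≤ m^x` whenever `e ≤ ⌊log₂ m⌋` and `m ≠ 0`. [folklore] -/
private theorem two_pow_mul_le_pow {x e m : ℕ} (hm : m ≠ 0) (he : e ≤ Nat.log 2 m) : 2 ^ (x * e) ≤ m ^ x := by
  calc 2 ^ (x * e) ≤ 2 ^ (x * Nat.log 2 m) := Nat.pow_le_pow_right (by norm_num) (Nat.mul_le_mul_left x he)
    _ = (2 ^ Nat.log 2 m) ^ x := by rw [mul_comm, pow_mul]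
    _ ≤ m ^ x := Nat.pow_le_pow_left (Nat.pow_log_le_self 2 hm) x

/-- `d^(3d) ≤ m^3` when `d·d ≤ ⌊log₂ m⌋` and `m ≠ 0` (`d ≤ 2^d`). [folklore] -/
private theorem pow_three_mul_le {d m : ℕ} (hm : m ≠ 0) (hdd : d * d ≤ Nat.log 2 m) : d ^ (3 * d) ≤ m ^ 3 := by
  calc d ^ (3 * d) ≤ (2 ^ d) ^ (3 * d) := Nat.pow_le_pow_left (Nat.lt_two_pow_self).le _
    _ = 2 ^ (3 * (d * d)) := by rw [← pow_mul]; ring_nf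
    _ ≤ m ^ 3 := two_pow_mul_le_pow hm hdd

/-- `m^x < 2^((⌊log₂ m⌋+1)·x) ≤ 2^(2·⌊log₂ m⌋·x)` for `m ≥ 2`. [folklore] -/
private theorem pow_lt_two_pow {m x : ℕ} (hm : 2 ≤ m) : m ^ x ≤ 2 ^ (2 * Nat.log 2 m * x) := by
  have h1 : m < 2 ^ (Nat.log 2 m + 1) := Nat.lt_pow_succ_log_self (by norm_num) m
  have hL : 1 ≤ Nat.log 2 m := Nat.le_log_of_pow_le (by norm_num) (by simpa using hm)
  calc m ^ x ≤ (2 ^ (Nat.log 2 m + 1)) ^ x := Nat.pow_le_pow_left h1.le x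
    _ = 2 ^ ((Nat.log 2 m + 1) * x) := by rw [← pow_mul]
    _ ≤ 2 ^ (2 * Nat.log 2 m * x) :=
        Nat.pow_le_pow_right (by norm_num) (Nat.mul_le_mul_right x (by omega))

/-! ### The bridge -/

/-- **The tree-bias bridge** (decomp-valiant lens 4, g12): unrolling, depth-preserving set-multilinearisation,
the tree-bias bound for set-multilinear `IMM` formulas (LST 2022 Thm. 3) and the open growth statement for
the tree bias of words fitting `IMM_{m,⌊√log₂ m⌋}` together give homogeneous `IMM` hardness at every depth
slope — in particular the crux `HomImmHardTwoOne = HomImmHardAt 2 1`.  Exponent bookkeeping: the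
set-multilinear formula has edge size `≤ m^{K₁·u(Γ+1) + K₀}`, `d^{3d} ≤ m^3`, against `2^{C(Δ_max+1)⌊log₂ m⌋}`
with `C = 2K₁ + 2K₀ + 8`. [cite: LimayeSrinivasanTavenas2022, Thm. 3] [cite: LimayeSrinivasanTavenas2025,
Lemma 12] -/
theorem treeBiasBridge : TreeBiasBridge := by
  rintro ⟨u, hU⟩ ⟨a, hS⟩ hT hG p q c
  -- constants: edge size of the set-multilinear formula ≤ m^(K₁ Δ₁ + K₀), Δ₁ = u (Γ+1)
  obtain ⟨K₁, hK₁⟩ : ∃ K₁ : ℕ, K₁ = a * (c + 5) := ⟨_, rfl⟩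
  obtain ⟨K₀, hK₀⟩ : ∃ K₀ : ℕ, K₀ = 5 * a + 1 := ⟨_, rfl⟩
  obtain ⟨m₀, hG'⟩ := hG (u * p) (u * (c + 1)) (2 * K₁ + 2 * K₀ + 8)
  refine ⟨max m₀ (max (2 ^ 2 ^ 4) (max c 5)), fun m hm => ?_⟩
  -- thresholds
  have hmm₀ : m₀ ≤ m := le_trans (le_max_left _ _) hm
  have hmJ : 2 ^ 2 ^ 4 ≤ m := le_trans (le_trans (le_max_left _ _) (le_max_right _ _)) hm
  have hmc5 : max c 5 ≤ m := le_trans (le_trans (le_max_right _ _) (le_max_right _ _)) hm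
  have hmc : c ≤ m := le_trans (le_max_left _ _) hmc5
  have hm5 : 5 ≤ m := le_trans (le_max_right _ _) hmc5
  have hm0 : m ≠ 0 := by omega
  have hL₁J : 2 ^ 4 ≤ Nat.log 2 m := Nat.le_log_of_pow_le (by norm_num) hmJ
  have hL₁1 : 1 ≤ Nat.log 2 m := le_trans (by norm_num) hL₁J
  -- the conjecture instance at this `m`
  have hGm := hG' m hmm₀
  -- facts about d = ⌊√L₁⌋ before generalising it
  have hdd : Nat.sqrt (Nat.log 2 m) * Nat.sqrt (Nat.log 2 m) ≤ Nat.log 2 m := Nat.sqrt_le _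
  have hdm : Nat.sqrt (Nat.log 2 m) ≤ m := (Nat.sqrt_le_self _).trans (Nat.log_le_self 2 m)
  have hd4 : 4 ≤ Nat.sqrt (Nat.log 2 m) := by
    rw [Nat.le_sqrt]; exact le_trans (by norm_num) hL₁J
  generalize hdg : Nat.sqrt (Nat.log 2 m) = d at hdd hdm hd4 hGm ⊢
  generalize hjg : Nat.log 2 (Nat.log 2 m) = j at hGm ⊢
  intro D hhom hD hpd
  -- generalise the depth budget Γ := ⌊p log₂ j / q⌋ + c ≤ p log₂ j + c
  have hΓle : p * Nat.log 2 j / q + c ≤ p * Nat.log 2 j + c := by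
    have : p * Nat.log 2 j / q ≤ p * Nat.log 2 j := Nat.div_le_self _ _
    omega
  generalize hΓg : p * Nat.log 2 j / q + c = Γ at hpd hΓle
  -- Δmax := u p log₂ j + u (c+1) + 1 ≥ u (Γ+1) + 1
  have hΔ₁ : u * (Γ + 1) ≤ u * p * Nat.log 2 j + u * (c + 1) := by
    calc u * (Γ + 1) ≤ u * (p * Nat.log 2 j + c + 1) := Nat.mul_le_mul_left _ (by omega)
      _ = u * p * Nat.log 2 j + u * (c + 1) := by ring
  generalize hMg : u * p * Nat.log 2 j + u * (c + 1) = M at hGm hΔ₁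
  -- by contradiction: a small circuit
  by_contra hsize
  rw [not_lt] at hsize
  -- (1) unroll
  have hfhom : (immPoly m d ℂ).IsHomogeneous d := immPoly_isHomogeneous_holds (k := ℂ) m d
  obtain ⟨P₁, hP₁F, hP₁hom, hP₁c, hP₁pd, hP₁E⟩ :=
    hU (Fin d × Fin m × Fin m) d Γ (immPoly m d ℂ) hfhom D hhom hD hpd
  -- (2) set-multilinearise (depth-preserving)
  obtain ⟨P₂, hP₂sml, hP₂c, hP₂pd, hP₂E⟩ :=
    hS (Fin d × Fin m × Fin m) (Fin d) Prod.fst (immPoly m d ℂ) (isSetMultilinear_immPoly m d)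
      P₁ hP₁F hP₁hom hP₁c
  -- (3) the word at depth Δ* := max 1 (productDepth P₂) ≤ M + 1 and the tree-bias bound
  have hΔst : max 1 P₂.productDepth ≤ M + 1 := by
    have : P₂.productDepth ≤ M := hP₂pd.trans (hP₁pd.trans hΔ₁)
    omega
  obtain ⟨sz, pos, hsz, hfit, hTB⟩ := hGm (max 1 P₂.productDepth) hΔst
  have hlow := hT m d (max 1 P₂.productDepth) _ sz pos (le_max_left _ _) hsz hfit hTB P₂ hP₂sml hP₂c
    (le_max_right _ _)
  rw [Nat.mul_div_cancel_left _ (by norm_num : 0 < 2)] at hlow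
  -- (4) the upper bound  E₂ + 1 ≤ m^(K₁ u(Γ+1) + K₀)
  have hcard : Fintype.card (Fin d × Fin m × Fin m) = d * (m * m) := by simp [Fintype.card_prod]
  have hcardι : Fintype.card (Fin d) = d := Fintype.card_fin d
  have hmpow : ∀ e, 1 ≤ e → m ≤ m ^ e := fun e he =>
    (pow_one m).symm.le.trans (Nat.pow_le_pow_right (by omega) he)
  have hmpos : ∀ e, 1 ≤ m ^ e := fun e => Nat.one_le_pow _ _ (by omega)
  have hX : D.size + Fintype.card (Fin d × Fin m × Fin m) + d + 2 ≤ m ^ (c + 4) := by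
    rw [hcard]
    have e1 : m ^ c ≤ m ^ (c + 3) := Nat.pow_le_pow_right (by omega) (by omega)
    have e2 : c ≤ m ^ (c + 3) := le_trans hmc (hmpow _ (by omega))
    have e3 : d * (m * m) ≤ m ^ (c + 3) := (Nat.mul_le_mul_right _ hdm).trans
      ((show m * (m * m) = m ^ 3 by ring).le.trans (Nat.pow_le_pow_right (by omega) (by omega)))
    have e4 : d ≤ m ^ (c + 3) := le_trans hdm (hmpow _ (by omega))
    have e5 : 2 ≤ m ^ (c + 3) := le_trans (by omega : 2 ≤ m) (hmpow _ (by omega))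
    have h5 := sum5_le_pow_succ (e := c + 3) hm5 e1 e2 e3 e4 e5
    have hs : D.size ≤ m ^ c + c := hsize
    have h34 : m ^ (c + 3 + 1) = m ^ (c + 4) := rfl
    omega
  have hE₁ : P₁.edgeSize ≤ m ^ ((c + 4) * (u * (Γ + 1))) := by
    calc P₁.edgeSize ≤ (D.size + Fintype.card (Fin d × Fin m × Fin m) + d + 2) ^ (u * (Γ + 1)) := hP₁E
      _ ≤ (m ^ (c + 4)) ^ (u * (Γ + 1)) := Nat.pow_le_pow_left hX _
      _ = m ^ ((c + 4) * (u * (Γ + 1))) := by rw [← pow_mul]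
  generalize hW₁g : (c + 4) * (u * (Γ + 1)) = W₁ at hE₁
  have hY : P₁.edgeSize + Fintype.card (Fin d × Fin m × Fin m) + 2 ≤ m ^ (W₁ + 4) := by
    rw [hcard]
    have e1 : P₁.edgeSize ≤ m ^ (W₁ + 3) := le_trans hE₁ (Nat.pow_le_pow_right (by omega) (by omega))
    have e3 : d * (m * m) ≤ m ^ (W₁ + 3) := (Nat.mul_le_mul_right _ hdm).trans
      ((show m * (m * m) = m ^ 3 by ring).le.trans (Nat.pow_le_pow_right (by omega) (by omega)))
    have e5 : 2 ≤ m ^ (W₁ + 3) := le_trans (by omega : 2 ≤ m) (hmpow _ (by omega))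
    have h5 := sum5_le_pow_succ (x₄ := 0) (x₅ := 0) hm5 e1 e3 e5 (Nat.zero_le _) (Nat.zero_le _)
    have h34 : m ^ (W₁ + 3 + 1) = m ^ (W₁ + 4) := rfl
    omega
  have h2pow : 2 ^ (a * Fintype.card (Fin d) * Fintype.card (Fin d) * (P₁.productDepth + 1)) ≤
      m ^ (a * (u * (Γ + 1) + 1)) := by
    rw [hcardι]
    have hmono : a * d * d * (P₁.productDepth + 1) ≤ a * (u * (Γ + 1) + 1) * (d * d) := by
      have : P₁.productDepth + 1 ≤ u * (Γ + 1) + 1 := by omega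
      calc a * d * d * (P₁.productDepth + 1) ≤ a * d * d * (u * (Γ + 1) + 1) :=
          Nat.mul_le_mul_left _ this
        _ = a * (u * (Γ + 1) + 1) * (d * d) := by ring
    calc 2 ^ (a * d * d * (P₁.productDepth + 1)) ≤ 2 ^ (a * (u * (Γ + 1) + 1) * (d * d)) :=
          Nat.pow_le_pow_right (by norm_num) hmono
      _ ≤ m ^ (a * (u * (Γ + 1) + 1)) := two_pow_mul_le_pow hm0 hdd
  have hle : a * (W₁ + 4) + a * (u * (Γ + 1) + 1) + 1 ≤ K₁ * (u * (Γ + 1)) + K₀ := by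
    rw [← hW₁g, hK₁, hK₀]; ring_nf; omega
  have hE₂ : P₂.edgeSize + 1 ≤ m ^ (K₁ * (u * (Γ + 1)) + K₀) := by
    have h1 : P₂.edgeSize ≤ m ^ (a * (W₁ + 4) + a * (u * (Γ + 1) + 1)) := by
      calc P₂.edgeSize ≤ (P₁.edgeSize + Fintype.card (Fin d × Fin m × Fin m) + 2) ^ a *
            2 ^ (a * Fintype.card (Fin d) * Fintype.card (Fin d) * (P₁.productDepth + 1)) := hP₂E
        _ ≤ (m ^ (W₁ + 4)) ^ a * m ^ (a * (u * (Γ + 1) + 1)) :=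
            Nat.mul_le_mul (Nat.pow_le_pow_left hY _) h2pow
        _ = m ^ (a * (W₁ + 4) + a * (u * (Γ + 1) + 1)) := by
            rw [← pow_mul, ← pow_add, mul_comm (W₁ + 4)]
    generalize hVg : a * (W₁ + 4) + a * (u * (Γ + 1) + 1) = V at h1 hle
    have h2 : m ^ V + 1 ≤ m ^ (V + 1) := by
      calc m ^ V + 1 ≤ m ^ V + m ^ V := Nat.add_le_add_left (hmpos _) _
        _ = 2 * m ^ V := by ring
        _ ≤ m * m ^ V := Nat.mul_le_mul_right _ (by omega)
        _ = m ^ (V + 1) := by ring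
    have h3 : m ^ (V + 1) ≤ m ^ (K₁ * (u * (Γ + 1)) + K₀) := Nat.pow_le_pow_right (by omega) hle
    omega
  -- (5) d^(3d)(E₂+1) ≤ m^(3 + K₁ Δ₁ + K₀) ≤ 2^(2 log₂ m (3 + K₁ M + K₀)) < 2^(C (M+2) log₂ m)
  have hup : d ^ (3 * d) * (P₂.edgeSize + 1) ≤ 2 ^ (2 * Nat.log 2 m * (3 + K₁ * M + K₀)) := by
    calc d ^ (3 * d) * (P₂.edgeSize + 1) ≤ m ^ 3 * m ^ (K₁ * (u * (Γ + 1)) + K₀) :=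
          Nat.mul_le_mul (pow_three_mul_le hm0 hdd) hE₂
      _ = m ^ (3 + (K₁ * (u * (Γ + 1)) + K₀)) := (pow_add _ _ _).symm
      _ ≤ m ^ (3 + K₁ * M + K₀) := Nat.pow_le_pow_right (by omega)
          (by have := Nat.mul_le_mul_left K₁ hΔ₁; omega)
      _ ≤ 2 ^ (2 * Nat.log 2 m * (3 + K₁ * M + K₀)) := pow_lt_two_pow (by omega)
  have hexp : 2 * Nat.log 2 m * (3 + K₁ * M + K₀) < (2 * K₁ + 2 * K₀ + 8) * (M + 2) * Nat.log 2 m := by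
    have h0 : (2 * K₁ + 2 * K₀ + 8) * (M + 2) =
        2 * (K₁ * M) + 2 * (K₀ * M) + 8 * M + 4 * K₁ + 4 * K₀ + 16 := by ring
    have h1 : 2 * (3 + K₁ * M + K₀) < (2 * K₁ + 2 * K₀ + 8) * (M + 2) := by rw [h0]; omega
    calc 2 * Nat.log 2 m * (3 + K₁ * M + K₀) = (2 * (3 + K₁ * M + K₀)) * Nat.log 2 m := by ring
      _ < (2 * K₁ + 2 * K₀ + 8) * (M + 2) * Nat.log 2 m := Nat.mul_lt_mul_of_pos_right h1 (by omega)
  have hlt : 2 ^ (2 * Nat.log 2 m * (3 + K₁ * M + K₀)) <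
      2 ^ ((2 * K₁ + 2 * K₀ + 8) * (M + 2) * Nat.log 2 m) := Nat.pow_lt_pow_right (by norm_num) hexp
  omega

/-- **Corollary: the crux instance.** Under the four inputs, `HomImmHardAt 2 1` (= the route decl
`HomImmHardTwoOne` by `Iff.rfl`), spelled verbatim. [cite: LimayeSrinivasanTavenas2022, Thm. 3] -/
theorem homImmHardAt_two_one_of_treeBias (hU : HomUnroll) (hS : SmlizeFormulaDepth)
    (hT : TreeBiasImmFormula) (hG : TreeBiasGrowth) :
    ∀ c : ℕ, ∃ m₀ : ℕ, ∀ m : ℕ, m₀ ≤ m →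
      ∀ D : ArithCircuit ℂ (Fin (Nat.sqrt (Nat.log 2 m)) × Fin m × Fin m),
        (∀ g ∈ ArithCircuit.gateValues D.gates, ∃ e : ℕ, g.IsHomogeneous e) →
        D.Computes (immPoly m (Nat.sqrt (Nat.log 2 m)) ℂ) →
        D.productDepth ≤ 2 * Nat.log 2 (Nat.log 2 (Nat.log 2 m)) / 1 + c → m ^ c + c < D.size :=
  treeBiasBridge hU hS hT hG 2 1

end Summit.ValiantsHypothesis.ValiantsHypothesis.Theorems.DepthWindow.TreeBias
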